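import Literature.MathematicalPhysics.QuantumFieldTheory.Balaban1983to89.B9Thm33G0DirXHolderFromDds
import Literature.MathematicalPhysics.QuantumFieldTheory.Balaban1983to89.B9GradViaDivLettersAtPinsHolder

/-!
# `Balaban1983to89.B9Thm33G0DirXHolderAtPins` — [B9] Theorems 3.12–3.13 (pp. 421–426): THE W-c FACE `Thm33G0DirX.pXdDH` AT node00-def-Y's MEMBERS —
# Φ^X_β∘∇_{U,ν}∘G₀∘D_U out of the scalar class `b_W` rescaled by (Lʲη)⁻¹, from the DERIVED `Thm33G0Dir` of the certificate and n06-l's kinematic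
# letter `J_μ(U)` (`DvcoKH = Σ_μ ∇*_{U,μ}∘JcoKH μ`), MODULO the Hölder J-letters at the exponents β + ε(β) — the member-level form of `B9Thm33G0DirXHolderFromDds`

T. Bałaban, *Propagators for lattice gauge theories in a background field*, Commun. Math. Phys. **99** (1985) 389–434
[`Balaban1985BackgroundPropagators`, "B9"]; [4] = T. Bałaban, *Propagators and renormalization transformations for lattice gauge
theories. II*, Commun. Math. Phys. **96** (1984) 223–250 [`Balaban1984PropagatorsII`].

statement-level skeleton of published theorems with citation tags; proofs where landed; nothing here is a claim about the Yang–Mills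
mass gap

THE PRINTED LOCI.  (3.45) p. 398 (*"‖ζ∇_UG(U)∇\*_Uλ‖_β ≦ B′₀(ε,β)(Lʲη)^{−β}(…)e^{−δ₀d(y,y′)}(‖λ‖_{β+ε} + |λ|)"*); (3.3) p. 390 (D_U componentwise = the ∇_{U,μ} of one
transported neighbour value); p. 398 (*"we may always replace ∇_U by ∇\*_U … in arbitrary place"*; the transfer of powers of Lʲη by [4] (2.60)); pp. 421–423 (the
left-form members of the (3.130)∕(3.138) expansions); [4] (2.51)–(2.56) pp. 232–233, Lemma 2.1 (2.60)–(2.61) p. 234.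

THE POINT.  `B9Thm33G0DirXHolderFromDds.pXdDH_of_thm33G0Dir_noLen` turns the field `Thm33G0DirX.pXdDH` (edition 30 binder `hX`, W-c face) into a theorem of the
certificate's DERIVED `Thm33G0Dir (𝔬12 x) (𝔭A x) (𝔡A x).Dd (𝔡A x).Dsd 1 (H x) (bHXA x) …` (`hG0C`) modulo TWO hypotheses: the kinematic decomposition `hDv : 𝔬.Dv U = Σ_μ
Dds U μ ∘ₗ J μ` and the no-length Hölder J-letters `hJ0 : ∀ β<1 μ, HasMaj b_W (bHX (β + ε β)) (J μ) (C_J·e^{−δ_J d})`.  At node00-def-Y's members the first IS dag-n06-l's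
theorem `B9GradViaDivLettersAtPins.DvcoKH_eq_sum` under the pins `hDvco12 : (𝔬12 x).Dv U = DvcoKH …` and `h𝔡As : (𝔡A x).Dsd U = fun μ => coordOpK (trBasis N) (fun _ =>
cdsBₗ … U μ)` (with `J μ := JcoKH … μ U`); THIS FILE discharges it:
* ★★ `pXdDH_pins` — every member `x`, every configuration `U`: for any scalar class `b_W`, any schedule `ε` (0 < ε β ≤ 1) and J-letters `hJ0` at `JcoKH … μ U`, the
  field shape `∀ ν β, 0 ≤ β → β < 1 → HasMaj (weightNorm b_W (Lʲη)⁻¹) (cNormR R₀ H₀ 𝔭.blkPX _ (β − 1)) ((𝔭.ΦX U β ∘ₗ Dd U ν ∘ₗ 𝔬.G0 U) ∘ₗ 𝔬.Dv U) (BdX β·e^{−δ₃d})` with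
  `BdX β ≥ (d+1)·(κ₀·(Bi2 (ε β) β·L₀)·(C_J·L₀)·c)`, `0 ≤ δ₃ ≤ δ₀ − αδ`, `δ₃ + σ ≤ δ_J − αδ`;
* ★★ `thm33G0DirX_pins` — with the zeroth-order probe `pX0` supplied (n06-w6 g0 `B9Thm33G0ProbeZeroAtCutPins.pX0_of_pins`; here the field as a hypothesis), the WHOLE
  face `Thm33G0DirX 𝔬 𝔭 Dd R₀ H₀ _ (weightNorm b_W (Lʲη)⁻¹) Bx0 BdX δ₀′ δ₃ U`.
* §2 ★★★ `pXdDH_pins_smallGauge` — the J-letters DISCHARGED by dag-n06-l g18's `B9GradViaDivLettersAtPinsHolder.hasMaj_JcoKH_holder_pins` at the SINGLE input exponent 1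
  (schedule ε β = 1 − β, so β + ε β = 1; `b_W := bHS … (sIK bI) 1`, the bond input family pinned at exponent 1 only: `hbHX1 : bHX 1 = bHK … bI 1`): for `bI` 1-faithful and
  direction-blind (`hβ1 hbI0`, the certificate's pins), `U ∈ Reg335` and the SMALL-FIELD-GAUGE binder at exponent 1 `hΘ : ∀ μ s s′, Adm ⟨s,μ⟩ ⟨s′,μ⟩ → tpar^{−1}·‖U_μ(s) − U_μ(s′)‖ ≤
  ϑ` (print's (3.35) gauge on one cube; NOT a consequence of Reg335 in a global gauge — n06-l's located note «GLOBAL vs PER-CUBE GAUGE»), the field `pXdDH` holds at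
  `bH := weightNorm (bHS … 1) (Lʲη)⁻¹` with `BdX β ≥ (d+1)·(κ₀·(Bi2 (1−β) β·L₀)·((2(1+ϑ)·cR39·e^{δ_J·rJ})·L₀)·c)`; ★★ `thm33G0DirX_pins_smallGauge` — the whole face from it and `pX0`.
So at the pin `bH13 x := weightNorm (bHS … 1) (Lʲη)⁻¹` the binder `hX` of the certificate is a theorem of `hG0C` + pins + `Reg335` + ONE small-field-gauge binder `hΘ` at
exponent 1 + numerics.  LOCATED REMARK X3 (v1.1, «INPUT-SCALE» + «SHARP-CUT JUMPS», for the pin owner; nothing asserted).  (i) n06-d's site class `bHS ε` weighs its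
Hölder part at the η-SCALE (`wS ε = ((|x′−x|_T∕nKT)^ε)⁻¹`, print's (3.40)), while print's INPUT norms (3.44)∕(3.45) and the bond class `bHK` (`tpar`) are ξ-scale; on one pair
`wS ε = ξ^{−ε}·tpar^{−ε}`, ξ = Lʲ∕nKT ≤ 1 — so §2's source is the STRONGEST currency the tree offers and every CONSUMER of `bH13` is a theorem at that pin.  (ii) BUT NO pin of
`bH13` inside the present class family (`bHK ∕ bHS ∕` a ξ-scale site twin) is PRODUCIBLE: these classes read `loc y` through the SHARP class restriction and count its
boundary jump (print's norm of a zero-extended SOURCE), and in `hasMaj_comp` the producer must bound `loc y″` of its UNCUT non-local output for every y″ — jump weight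
`t^{−γ} = L^{j(y″)γ}`, i.e. ≈ L^{j}× the sup-class size the derived `Letters3131.tb` delivers for T_b f.  Hence the displayed producer `Letters3131H.tbH ∕ tb₂H` is
UNSATISFIABLE AS TYPED at every such pin, and even at an honest (smoothly localised) `bH13` a J-letter INTO the jump-counting `bHK γ`, γ > 0, fails for pieces spanning
several classes.  Print avoids this with smooth localisers (`ζ ∈ C₀^∞(Δ̃(y))`, «supp λ ⊂ Δ̃(y′)», a smooth partition Σ_y ζ_y = 1).  CONSEQUENCE: §2 is a correct
theorem but must NOT be used to PIN `bH13` (it would make `hL3131H` vacuous); the honest state is `bH13` FREE with the D-orbit Hölder members and `hL3131H` displayed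
(jointly satisfiable by [B9]'s smooth class); §1 is the generic form to instantiate once a smooth-partition class family exists at def-Y's carriers (architecture item;
one-scale precedent: NE9's `B9Eq343BlockPartitionOfUnity` ∕ `B9Eq343BlockLocalisedHolderPieces`).  Ledger history: v1 p623784; v1.1 = this docstring correction only.

HONEST SCOPE.  Kernel bookkeeping over landed modules; the J-letters `hJ0`, the schema `Thm33G0Dir` (derived in the certificate from rows 19's displayed schemas), [4] Lemma 2.1
(`RowSum`) and the member facts (`Facts347`) are HYPOTHESES here; nothing of [B9] or [4] is asserted.  COUNT-NEUTRAL; `hX` NOT discharged by this file alone; N06 NOT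
discharged; one finite lattice at a time; nothing continuum, nothing about the mass gap ∕ Clay.  Cell `pub-ymgap` (HUMAN RULING D-0062 ∕ D-0154), Track A node N06 [B9],
W-c face `hX`, width seat `pub-ymgap-dag-n06-w6` (g0′), 2026-08-28.  NEW file; nothing landed is modified.
-/

noncomputable section

namespace Literature.MathematicalPhysics.QuantumFieldTheory.Balaban1983to89.B9Thm33G0DirXHolderAtPins

open Node00 B6KLevelCensusIndexV1 B9BackgroundsKLevelV1
open B11SectG (HasMaj BlockNorm RowSum)
open B9SectDSup (weightNorm)
open B9Thm34Ext (toB6)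
open B9Thm312Whole (GeoOK Ops)
open B9Thm312WholeClasses (cNormR)
open B9Thm312WholeDir (Thm33G0Dir)
open B9Thm312WholeStepDirFrom3131 (Thm33G0DirX)
open B9RWSums343Holder (HolderProbes)
open B9RWSums343to347Whole (Facts347)
open B9GeoNormsKLevelV1 (geo9K)
open B9CoReadingCoords (XBK coordOpK cdsBₗ)
open B9CoReadingCoordsS (XSK)
open B9CoReadingCoordsTranspose (TrIdx trBasis)
open B9PinMembersKLevelV1 (MemberY geo9Y bg9Y)
open B7Prop2SpecialUnitary (specialUnitaryUnits)
open Node00.OpsYSectDCoords (DvcoKH)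
open B9GradViaDivLettersAtPins (JcoKH DvcoKH_eq_sum rJ)
open B9GradViaDivLettersAtPinsHolder (hasMaj_JcoKH_holder_pins)
open B9Thm33G0DirXHolderFromDds (pXdDH_of_thm33G0Dir_noLen)
open B9CoReadingCoordsInput (bHK)
open B9CoReadingCoordsInputS (bHS)
open B9CoReadingCoordsS (sIK)
open B9CoRealizesRelAtLetters (RelB)
open B9Thm39ReadingCoords (cR39 cR39_nonneg)
open B6GlobalChartV1 (PV blkV1)
open B6Geom246MultiLevelTorus (geomT)
open scoped Matrix.Norms.L2Operator

variable {d ℓ : ℕ} {hd : 1 ≤ d + 1} {hL : Odd (ℓ + 1) ∧ 1 < ℓ + 1} {b₀ b₁ : ℝ}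
variable {Mstar : ℕ} {N : ℕ}
variable [∀ x : MemberY d ℓ hd hL b₀ b₁ Mstar, Fintype (geo9Y x).Site]

/-- ★★ **`Thm33G0DirX.pXdDH` AT THE PINS, MODULO THE HÖLDER J-LETTERS** — every member `x`, every configuration `U`: Φ^X_β∘∇_{U,ν}∘G₀∘D_U : `weightNorm b_W (Lʲη)⁻¹` →
𝔠_P^{(β−1)} with `BdX β·e^{−δ₃d}` for every ν and β ∈ [0,1), from the certificate's derived `Thm33G0Dir 𝔬 𝔭 Dd Dds R₀ H₀ bHX B₀ Bh Bi Bi2 δ₀ U` (its `h45m`), the pins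
`hDv : 𝔬.Dv U = DvcoKH …` (`hDvco12`) and `hDds : Dds U = fun μ => coordOpK (trBasis N) (fun _ => cdsBₗ … U μ)` (`h𝔡As`) — which make `𝔬.Dv U = Σ_μ Dds U μ ∘ₗ JcoKH … μ U`
dag-n06-l's `DvcoKH_eq_sum` — and no-length J-letters `hJ0` from `b_W` into `bHX (β + ε β)` along a schedule `ε`; `BdX β ≥ (d+1)·(κ₀·(Bi2 (ε β) β·L₀)·(C_J·L₀)·c)`,
`0 ≤ δ₃ ≤ δ₀ − αδ`, `δ₃ + σ ≤ δ_J − αδ`. [cite: Balaban1985BackgroundPropagators, Thm 3.3 (3.45) p.398 + p.398 (remarks after (3.47)) + (3.3) p.390 + pp.421–423; Balaban1984PropagatorsII, (2.51)–(2.56) pp.232–233 + Lemma 2.1 (2.60)–(2.61) p.234] -/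
theorem pXdDH_pins (x : MemberY d ℓ hd hL b₀ b₁ Mstar) {R₀ : ℝ} {H₀ : Prop} (hG : GeoOK (geo9Y x)) {σ c : ℝ} (hrow : RowSum (toB6 (geo9Y x) R₀ H₀) σ c)
    {dF : ℕ} {δF α L₀ : ℝ} (hF : Facts347 (geo9Y x) R₀ H₀ dF δF α L₀) {Z PX PY : Type} [Fintype PX] [Fintype PY]
    (𝔬 : Ops (geo9Y x) (bg9Y (Matrix (Fin N) (Fin N) ℂ) (specialUnitaryUnits (Fin N)) x) (XBK (TrIdx N) x.toKIdx) (XBK (TrIdx N) x.toKIdx) Z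
      (XSK (TrIdx N) x.toKIdx))
    (𝔭 : HolderProbes (geo9Y x) (bg9Y (Matrix (Fin N) (Fin N) ℂ) (specialUnitaryUnits (Fin N)) x) (XBK (TrIdx N) x.toKIdx) (XBK (TrIdx N) x.toKIdx) PX PY)
    {Dd Dds : (bg9Y (Matrix (Fin N) (Fin N) ℂ) (specialUnitaryUnits (Fin N)) x).Cfg → Fin (d + 1) → Module.End ℝ (XBK (TrIdx N) x.toKIdx → ℝ)}
    {bHX : ℝ → BlockNorm (toB6 (geo9Y x) R₀ H₀) (XBK (TrIdx N) x.toKIdx → ℝ)} {B₀ δ₀ : ℝ} {Bh Bi : ℝ → ℝ} {Bi2 : ℝ → ℝ → ℝ}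
    {U : (bg9Y (Matrix (Fin N) (Fin N) ℂ) (specialUnitaryUnits (Fin N)) x).Cfg}
    (h33 : Thm33G0Dir 𝔬 𝔭 Dd Dds R₀ H₀ bHX B₀ Bh Bi Bi2 δ₀ U)
    (hDv : 𝔬.Dv U = DvcoKH x.toKIdx (trBasis N) (bg9Y (Matrix (Fin N) (Fin N) ℂ) (specialUnitaryUnits (Fin N)) x) (fun U => U) U)
    (hDds : Dds U = fun μ => coordOpK (trBasis N) (fun _ : Fin (d + 1) => cdsBₗ x.toKIdx U μ))
    {bW : BlockNorm (toB6 (geo9Y x) R₀ H₀) (XSK (TrIdx N) x.toKIdx → ℝ)}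
    (ε : ℝ → ℝ) (hε : ∀ β, 0 ≤ β → β < 1 → 0 < ε β ∧ ε β ≤ 1) {CJ δJ κ₀ δ₃ : ℝ} {BdX : ℝ → ℝ}
    (hBi2 : ∀ e b', 0 < e → e ≤ 1 → 0 ≤ b' → b' < 1 → 0 ≤ Bi2 e b') (hCJ : 0 ≤ CJ) (hc : 0 ≤ c) (hκ : ∀ γ, (bHX γ).κ ≤ κ₀)
    (hδ₃ : 0 ≤ δ₃) (hδ₃0 : δ₃ ≤ δ₀ - α * δF) (hδ₃J : δ₃ + σ ≤ δJ - α * δF)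
    (hBdX : ∀ β, 0 ≤ β → β < 1 → ((d : ℝ) + 1) * (κ₀ * (Bi2 (ε β) β * L₀) * (CJ * L₀) * c) ≤ BdX β)
    (hJ0 : ∀ β, 0 ≤ β → β < 1 → ∀ μ, HasMaj bW (bHX (β + ε β))
      (JcoKH x.toKIdx (trBasis N) (bg9Y (Matrix (Fin N) (Fin N) ℂ) (specialUnitaryUnits (Fin N)) x) (fun U => U) μ U)
      (fun a a' => CJ * Real.exp (-(δJ * (geo9Y x).dist a a')))) :
    ∀ (ν : Fin (d + 1)) (β : ℝ), 0 ≤ β → β < 1 →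
      HasMaj (weightNorm bW (fun y => ((geo9Y x).len y)⁻¹) (fun y => inv_nonneg.mpr (hG.lenle y))) (cNormR R₀ H₀ 𝔭.blkPX hG.lenle (β - 1))
        ((𝔭.ΦX U β ∘ₗ Dd U ν ∘ₗ 𝔬.G0 U) ∘ₗ 𝔬.Dv U) (fun a a' => BdX β * Real.exp (-(δ₃ * (geo9Y x).dist a a'))) := by
  letI : Fintype (geo9K x.toKIdx).Site := (inferInstance : Fintype (geo9Y x).Site)
  -- the kinematic decomposition at the pins (dag-n06-l)
  have hDv' : 𝔬.Dv U = ∑ μ, Dds U μ ∘ₗ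
      JcoKH x.toKIdx (trBasis N) (bg9Y (Matrix (Fin N) (Fin N) ℂ) (specialUnitaryUnits (Fin N)) x) (fun U => U) μ U := by
    rw [hDv, hDds]
    exact DvcoKH_eq_sum x.toKIdx (trBasis N) (bg9Y (Matrix (Fin N) (Fin N) ℂ) (specialUnitaryUnits (Fin N)) x) (fun U => U) U
  have hBdX' : ∀ β, 0 ≤ β → β < 1 → (Fintype.card (Fin (d + 1)) : ℝ) * (κ₀ * (Bi2 (ε β) β * L₀) * (CJ * L₀) * c) ≤ BdX β := by
    intro β h0 h1
    rw [Fintype.card_fin, Nat.cast_add, Nat.cast_one]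
    exact hBdX β h0 h1
  exact pXdDH_of_thm33G0Dir_noLen hG hrow hF h33 hG.lenle ε hε hBi2 hCJ hc hκ hδ₃ hδ₃0 hδ₃J hBdX' hDv' hJ0

/-- ★★ **THE WHOLE W-c FACE `Thm33G0DirX` AT THE PINS, MODULO THE HÖLDER J-LETTERS AND THE ZEROTH-ORDER PROBE** — with `pX0` supplied in its own shape (n06-w6 g0
`B9Thm33G0ProbeZeroAtCutPins.pX0_of_pins` at the cut probe carrier) and `pXdDH` from `pXdDH_pins`: `Thm33G0DirX 𝔬 𝔭 Dd R₀ H₀ _ (weightNorm b_W (Lʲη)⁻¹) Bx0 BdX δ₀′ δ₃ U`.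
[cite: Balaban1985BackgroundPropagators, Thm 3.3 p.399 + (3.42)–(3.45) pp.397–398 + (3.3) p.390 + pp.421–423; Balaban1984PropagatorsII, (2.51)–(2.56) pp.232–233 + Lemma 2.1 (2.60)–(2.61) p.234] -/
theorem thm33G0DirX_pins (x : MemberY d ℓ hd hL b₀ b₁ Mstar) {R₀ : ℝ} {H₀ : Prop} (hG : GeoOK (geo9Y x)) {σ c : ℝ} (hrow : RowSum (toB6 (geo9Y x) R₀ H₀) σ c)
    {dF : ℕ} {δF α L₀ : ℝ} (hF : Facts347 (geo9Y x) R₀ H₀ dF δF α L₀) {Z PX PY : Type} [Fintype PX] [Fintype PY]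
    (𝔬 : Ops (geo9Y x) (bg9Y (Matrix (Fin N) (Fin N) ℂ) (specialUnitaryUnits (Fin N)) x) (XBK (TrIdx N) x.toKIdx) (XBK (TrIdx N) x.toKIdx) Z
      (XSK (TrIdx N) x.toKIdx))
    (𝔭 : HolderProbes (geo9Y x) (bg9Y (Matrix (Fin N) (Fin N) ℂ) (specialUnitaryUnits (Fin N)) x) (XBK (TrIdx N) x.toKIdx) (XBK (TrIdx N) x.toKIdx) PX PY)
    {Dd Dds : (bg9Y (Matrix (Fin N) (Fin N) ℂ) (specialUnitaryUnits (Fin N)) x).Cfg → Fin (d + 1) → Module.End ℝ (XBK (TrIdx N) x.toKIdx → ℝ)}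
    {bHX : ℝ → BlockNorm (toB6 (geo9Y x) R₀ H₀) (XBK (TrIdx N) x.toKIdx → ℝ)} {B₀ δ₀ : ℝ} {Bh Bi : ℝ → ℝ} {Bi2 : ℝ → ℝ → ℝ}
    {U : (bg9Y (Matrix (Fin N) (Fin N) ℂ) (specialUnitaryUnits (Fin N)) x).Cfg}
    (h33 : Thm33G0Dir 𝔬 𝔭 Dd Dds R₀ H₀ bHX B₀ Bh Bi Bi2 δ₀ U)
    (hDv : 𝔬.Dv U = DvcoKH x.toKIdx (trBasis N) (bg9Y (Matrix (Fin N) (Fin N) ℂ) (specialUnitaryUnits (Fin N)) x) (fun U => U) U)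
    (hDds : Dds U = fun μ => coordOpK (trBasis N) (fun _ : Fin (d + 1) => cdsBₗ x.toKIdx U μ))
    {bW : BlockNorm (toB6 (geo9Y x) R₀ H₀) (XSK (TrIdx N) x.toKIdx → ℝ)}
    (ε : ℝ → ℝ) (hε : ∀ β, 0 ≤ β → β < 1 → 0 < ε β ∧ ε β ≤ 1) {CJ δJ κ₀ δ₃ δ₀' : ℝ} {Bx0 BdX : ℝ → ℝ}
    (hBi2 : ∀ e b', 0 < e → e ≤ 1 → 0 ≤ b' → b' < 1 → 0 ≤ Bi2 e b') (hCJ : 0 ≤ CJ) (hc : 0 ≤ c) (hκ : ∀ γ, (bHX γ).κ ≤ κ₀)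
    (hδ₃ : 0 ≤ δ₃) (hδ₃0 : δ₃ ≤ δ₀ - α * δF) (hδ₃J : δ₃ + σ ≤ δJ - α * δF)
    (hBdX : ∀ β, 0 ≤ β → β < 1 → ((d : ℝ) + 1) * (κ₀ * (Bi2 (ε β) β * L₀) * (CJ * L₀) * c) ≤ BdX β)
    (hJ0 : ∀ β, 0 ≤ β → β < 1 → ∀ μ, HasMaj bW (bHX (β + ε β))
      (JcoKH x.toKIdx (trBasis N) (bg9Y (Matrix (Fin N) (Fin N) ℂ) (specialUnitaryUnits (Fin N)) x) (fun U => U) μ U)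
      (fun a a' => CJ * Real.exp (-(δJ * (geo9Y x).dist a a'))))
    (hpX0 : ∀ β : ℝ, 0 ≤ β → β < 1 → HasMaj (cNormR R₀ H₀ 𝔬.blk hG.lenle 0) (cNormR R₀ H₀ 𝔭.blkPX hG.lenle (β - 2))
      (𝔭.ΦX U β ∘ₗ 𝔬.G0 U) (fun a a' => Bx0 β * Real.exp (-(δ₀' * (geo9Y x).dist a a')))) :
    Thm33G0DirX 𝔬 𝔭 Dd R₀ H₀ hG.lenle (weightNorm bW (fun y => ((geo9Y x).len y)⁻¹) (fun y => inv_nonneg.mpr (hG.lenle y))) Bx0 BdX δ₀' δ₃ U :=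
  ⟨hpX0, pXdDH_pins x hG hrow hF 𝔬 𝔭 h33 hDv hDds ε hε hBi2 hCJ hc hκ hδ₃ hδ₃0 hδ₃J hBdX hJ0⟩

/-! ## §2 ★★★ The J-letters discharged by dag-n06-l's Hölder letter under the small-field-gauge binder, at the single exponent 1 -/

section SmallGauge

variable [NeZero N] [∀ x : MemberY d ℓ hd hL b₀ b₁ Mstar, DecidableRel (RelB x.toKIdx)]

/-- ★★★ **`Thm33G0DirX.pXdDH` AT THE PINS UNDER THE SMALL-FIELD-GAUGE BINDER** — every member `x`, every `U ∈ Reg335` in small-gauge position at exponent 1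
(`hΘ`): with the scalar class PINNED to `weightNorm (bHS … (sIK bI) 1) (Lʲη)⁻¹` (flat site input class at exponent ONE, one length) and the bond input family read at
exponent 1 (`hbHX1 : bHX 1 = bHK … bI 1`, the certificate's `hbHXA` at ε = 1), the (3.45)-type field Φ^X_β∘∇_{U,ν}∘G₀∘D_U : bH → 𝔠_P^{(β−1)} holds for EVERY ν and β ∈ [0,1)
with `BdX β·e^{−δ₃d}`, `BdX β ≥ (d+1)·(κ₀·(Bi2 (1−β) β·L₀)·((2(1+ϑ)·cR39 (trBasis N)·e^{δ_J·rJ})·L₀)·c)`, `0 ≤ δ_J`, `0 ≤ δ₃ ≤ δ₀ − αδ`, `δ₃ + σ ≤ δ_J − αδ` — from the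
certificate's derived `Thm33G0Dir` (its `h45m` at ε = 1 − β), dag-n06-l's `DvcoKH_eq_sum` and `hasMaj_JcoKH_holder_pins` (J_μ : bHS 1 → bHK 1 under `hΘ`), composed by
`pXdDH_pins`.  Print's B′₀(1 − β, β) → ∞ as β → 1 is carried by `Bi2 (1−β) β` inside `BdX β`.  (The source here is the η-scale class `bHS … 1` — the strongest
site input norm of the tree.  CAVEAT (header REMARK X3 (ii), v1.1): pinning the certificate's `bH13` to this source makes the displayed PRODUCER `Letters3131H.tbH ∕ tb₂H`
unsatisfiable as typed (sharp-cut jump terms); use this theorem as a consumer-side reduction, NOT as a pin.)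
[cite: Balaban1985BackgroundPropagators, Thm 3.3 (3.45) p.398 + (3.35) p.396 + (3.39)–(3.41) p.397 + (3.3) p.390 + pp.421–423; Balaban1984PropagatorsII, (2.51)–(2.56) pp.232–233 + Lemma 2.1 (2.60)–(2.61) p.234 + (2.137) p.247] -/
theorem pXdDH_pins_smallGauge (x : MemberY d ℓ hd hL b₀ b₁ Mstar) {bI : FBondY x.toKIdx → IBondY x.toKIdx}
    (hβ1 : ∀ f : FBondY x.toKIdx, (geomT x.D).dist (B6Ineq2142KLevelV1.β x.hN x.D x.hk (bI f)) (blkV1 x.hN x.D f) ≤ 1)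
    (hbI0 : ∀ f : FBondY x.toKIdx, bI f = bI ⟨f.src, 0⟩) {c35 α₀ : ℝ}
    {U : (bg9Y (Matrix (Fin N) (Fin N) ℂ) (specialUnitaryUnits (Fin N)) x).Cfg}
    (hU : (bg9Y (Matrix (Fin N) (Fin N) ℂ) (specialUnitaryUnits (Fin N)) x).Reg335 c35 α₀ U) {ϑ : ℝ} (hϑ : 0 ≤ ϑ)
    (hΘ : ∀ (μ : Fin (d + 1)) (s s' : Site (PV d ℓ x.toKIdx.m x.toKIdx.K hd hL) 0), Adm x.toKIdx ⟨s, μ⟩ ⟨s', μ⟩ →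
      tpar x.toKIdx ⟨s, μ⟩ ⟨s', μ⟩ ^ (-(1 : ℝ)) * ‖(U μ s : Matrix (Fin N) (Fin N) ℂ) - (U μ s' : Matrix (Fin N) (Fin N) ℂ)‖ ≤ ϑ)
    {R₀ : ℝ} {H₀ : Prop} (hG : GeoOK (geo9Y x)) {σ c : ℝ} (hrow : RowSum (toB6 (geo9Y x) R₀ H₀) σ c)
    {dF : ℕ} {δF α L₀ : ℝ} (hF : Facts347 (geo9Y x) R₀ H₀ dF δF α L₀) {Z PX PY : Type} [Fintype PX] [Fintype PY]
    (𝔬 : Ops (geo9Y x) (bg9Y (Matrix (Fin N) (Fin N) ℂ) (specialUnitaryUnits (Fin N)) x) (XBK (TrIdx N) x.toKIdx) (XBK (TrIdx N) x.toKIdx) Z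
      (XSK (TrIdx N) x.toKIdx))
    (𝔭 : HolderProbes (geo9Y x) (bg9Y (Matrix (Fin N) (Fin N) ℂ) (specialUnitaryUnits (Fin N)) x) (XBK (TrIdx N) x.toKIdx) (XBK (TrIdx N) x.toKIdx) PX PY)
    {Dd Dds : (bg9Y (Matrix (Fin N) (Fin N) ℂ) (specialUnitaryUnits (Fin N)) x).Cfg → Fin (d + 1) → Module.End ℝ (XBK (TrIdx N) x.toKIdx → ℝ)}
    {bHX : ℝ → BlockNorm (toB6 (geo9Y x) R₀ H₀) (XBK (TrIdx N) x.toKIdx → ℝ)} {B₀ δ₀ : ℝ} {Bh Bi : ℝ → ℝ} {Bi2 : ℝ → ℝ → ℝ}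
    (h33 : Thm33G0Dir 𝔬 𝔭 Dd Dds R₀ H₀ bHX B₀ Bh Bi Bi2 δ₀ U)
    (hbHX1 : bHX 1 = (letI : Fintype (geo9K x.toKIdx).Site := (inferInstance : Fintype (geo9Y x).Site)
      bHK (R := R₀) (H := H₀) x.toKIdx bI 1))
    (hDv : 𝔬.Dv U = DvcoKH x.toKIdx (trBasis N) (bg9Y (Matrix (Fin N) (Fin N) ℂ) (specialUnitaryUnits (Fin N)) x) (fun U => U) U)
    (hDds : Dds U = fun μ => coordOpK (trBasis N) (fun _ : Fin (d + 1) => cdsBₗ x.toKIdx U μ))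
    {δJ κ₀ δ₃ : ℝ} {BdX : ℝ → ℝ}
    (hBi2 : ∀ e b', 0 < e → e ≤ 1 → 0 ≤ b' → b' < 1 → 0 ≤ Bi2 e b') (hc : 0 ≤ c) (hκ : ∀ γ, (bHX γ).κ ≤ κ₀) (hδJ : 0 ≤ δJ)
    (hδ₃ : 0 ≤ δ₃) (hδ₃0 : δ₃ ≤ δ₀ - α * δF) (hδ₃J : δ₃ + σ ≤ δJ - α * δF)
    (hBdX : ∀ β, 0 ≤ β → β < 1 →
      ((d : ℝ) + 1) * (κ₀ * (Bi2 (1 - β) β * L₀) * ((2 * (1 + ϑ) * cR39 (trBasis N) * Real.exp (δJ * rJ d ℓ)) * L₀) * c) ≤ BdX β) :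
    letI : Fintype (geo9K x.toKIdx).Site := (inferInstance : Fintype (geo9Y x).Site)
    ∀ (ν : Fin (d + 1)) (β : ℝ), 0 ≤ β → β < 1 →
      HasMaj (weightNorm (bHS (R := R₀) (H := H₀) x.toKIdx (sIK x.toKIdx bI) 1) (fun y => ((geo9Y x).len y)⁻¹) (fun y => inv_nonneg.mpr (hG.lenle y)))
        (cNormR R₀ H₀ 𝔭.blkPX hG.lenle (β - 1)) ((𝔭.ΦX U β ∘ₗ Dd U ν ∘ₗ 𝔬.G0 U) ∘ₗ 𝔬.Dv U)
        (fun a a' => BdX β * Real.exp (-(δ₃ * (geo9Y x).dist a a'))) := by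
  letI : Fintype (geo9K x.toKIdx).Site := (inferInstance : Fintype (geo9Y x).Site)
  have hCJ : 0 ≤ 2 * (1 + ϑ) * cR39 (trBasis N) * Real.exp (δJ * rJ d ℓ) := by
    have := cR39_nonneg (trBasis N); positivity
  refine pXdDH_pins x hG hrow hF 𝔬 𝔭 h33 hDv hDds (fun β => 1 - β) (fun β h0 h1 => ⟨by linarith, by linarith⟩) hBi2 hCJ hc hκ hδ₃ hδ₃0
    hδ₃J hBdX fun β _ _ μ => ?_
  have e : β + (1 - β) = 1 := by ring
  rw [e, hbHX1]
  exact hasMaj_JcoKH_holder_pins x hβ1 hbI0 hU zero_le_one le_rfl hϑ hΘ hδJ μ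

/-- ★★ **THE WHOLE W-c FACE `Thm33G0DirX` AT THE PINS UNDER THE SMALL-FIELD-GAUGE BINDER**: `pXdDH_pins_smallGauge` + the zeroth-order probe `pX0` (n06-w6 g0
`B9Thm33G0ProbeZeroAtCutPins.pX0_of_pins`; here the field as a hypothesis) give `Thm33G0DirX 𝔬 𝔭 Dd R₀ H₀ _ (weightNorm (bHS … 1) (Lʲη)⁻¹) Bx0 BdX δ₀′ δ₃ U`.
[cite: Balaban1985BackgroundPropagators, Thm 3.3 p.399 + (3.42)–(3.45) pp.397–398 + (3.35) p.396 + (3.3) p.390 + pp.421–423; Balaban1984PropagatorsII, (2.51)–(2.56) pp.232–233 + Lemma 2.1 (2.60)–(2.61) p.234] -/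
theorem thm33G0DirX_pins_smallGauge (x : MemberY d ℓ hd hL b₀ b₁ Mstar) {bI : FBondY x.toKIdx → IBondY x.toKIdx}
    (hβ1 : ∀ f : FBondY x.toKIdx, (geomT x.D).dist (B6Ineq2142KLevelV1.β x.hN x.D x.hk (bI f)) (blkV1 x.hN x.D f) ≤ 1)
    (hbI0 : ∀ f : FBondY x.toKIdx, bI f = bI ⟨f.src, 0⟩) {c35 α₀ : ℝ}
    {U : (bg9Y (Matrix (Fin N) (Fin N) ℂ) (specialUnitaryUnits (Fin N)) x).Cfg}
    (hU : (bg9Y (Matrix (Fin N) (Fin N) ℂ) (specialUnitaryUnits (Fin N)) x).Reg335 c35 α₀ U) {ϑ : ℝ} (hϑ : 0 ≤ ϑ)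
    (hΘ : ∀ (μ : Fin (d + 1)) (s s' : Site (PV d ℓ x.toKIdx.m x.toKIdx.K hd hL) 0), Adm x.toKIdx ⟨s, μ⟩ ⟨s', μ⟩ →
      tpar x.toKIdx ⟨s, μ⟩ ⟨s', μ⟩ ^ (-(1 : ℝ)) * ‖(U μ s : Matrix (Fin N) (Fin N) ℂ) - (U μ s' : Matrix (Fin N) (Fin N) ℂ)‖ ≤ ϑ)
    {R₀ : ℝ} {H₀ : Prop} (hG : GeoOK (geo9Y x)) {σ c : ℝ} (hrow : RowSum (toB6 (geo9Y x) R₀ H₀) σ c)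
    {dF : ℕ} {δF α L₀ : ℝ} (hF : Facts347 (geo9Y x) R₀ H₀ dF δF α L₀) {Z PX PY : Type} [Fintype PX] [Fintype PY]
    (𝔬 : Ops (geo9Y x) (bg9Y (Matrix (Fin N) (Fin N) ℂ) (specialUnitaryUnits (Fin N)) x) (XBK (TrIdx N) x.toKIdx) (XBK (TrIdx N) x.toKIdx) Z
      (XSK (TrIdx N) x.toKIdx))
    (𝔭 : HolderProbes (geo9Y x) (bg9Y (Matrix (Fin N) (Fin N) ℂ) (specialUnitaryUnits (Fin N)) x) (XBK (TrIdx N) x.toKIdx) (XBK (TrIdx N) x.toKIdx) PX PY)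
    {Dd Dds : (bg9Y (Matrix (Fin N) (Fin N) ℂ) (specialUnitaryUnits (Fin N)) x).Cfg → Fin (d + 1) → Module.End ℝ (XBK (TrIdx N) x.toKIdx → ℝ)}
    {bHX : ℝ → BlockNorm (toB6 (geo9Y x) R₀ H₀) (XBK (TrIdx N) x.toKIdx → ℝ)} {B₀ δ₀ : ℝ} {Bh Bi : ℝ → ℝ} {Bi2 : ℝ → ℝ → ℝ}
    (h33 : Thm33G0Dir 𝔬 𝔭 Dd Dds R₀ H₀ bHX B₀ Bh Bi Bi2 δ₀ U)
    (hbHX1 : bHX 1 = (letI : Fintype (geo9K x.toKIdx).Site := (inferInstance : Fintype (geo9Y x).Site)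
      bHK (R := R₀) (H := H₀) x.toKIdx bI 1))
    (hDv : 𝔬.Dv U = DvcoKH x.toKIdx (trBasis N) (bg9Y (Matrix (Fin N) (Fin N) ℂ) (specialUnitaryUnits (Fin N)) x) (fun U => U) U)
    (hDds : Dds U = fun μ => coordOpK (trBasis N) (fun _ : Fin (d + 1) => cdsBₗ x.toKIdx U μ))
    {δJ κ₀ δ₃ δ₀' : ℝ} {Bx0 BdX : ℝ → ℝ}
    (hBi2 : ∀ e b', 0 < e → e ≤ 1 → 0 ≤ b' → b' < 1 → 0 ≤ Bi2 e b') (hc : 0 ≤ c) (hκ : ∀ γ, (bHX γ).κ ≤ κ₀) (hδJ : 0 ≤ δJ)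
    (hδ₃ : 0 ≤ δ₃) (hδ₃0 : δ₃ ≤ δ₀ - α * δF) (hδ₃J : δ₃ + σ ≤ δJ - α * δF)
    (hBdX : ∀ β, 0 ≤ β → β < 1 →
      ((d : ℝ) + 1) * (κ₀ * (Bi2 (1 - β) β * L₀) * ((2 * (1 + ϑ) * cR39 (trBasis N) * Real.exp (δJ * rJ d ℓ)) * L₀) * c) ≤ BdX β)
    (hpX0 : ∀ β : ℝ, 0 ≤ β → β < 1 → HasMaj (cNormR R₀ H₀ 𝔬.blk hG.lenle 0) (cNormR R₀ H₀ 𝔭.blkPX hG.lenle (β - 2))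
      (𝔭.ΦX U β ∘ₗ 𝔬.G0 U) (fun a a' => Bx0 β * Real.exp (-(δ₀' * (geo9Y x).dist a a')))) :
    letI : Fintype (geo9K x.toKIdx).Site := (inferInstance : Fintype (geo9Y x).Site)
    Thm33G0DirX 𝔬 𝔭 Dd R₀ H₀ hG.lenle
      (weightNorm (bHS (R := R₀) (H := H₀) x.toKIdx (sIK x.toKIdx bI) 1) (fun y => ((geo9Y x).len y)⁻¹) (fun y => inv_nonneg.mpr (hG.lenle y)))
      Bx0 BdX δ₀' δ₃ U :=
  ⟨hpX0, pXdDH_pins_smallGauge x hβ1 hbI0 hU hϑ hΘ hG hrow hF 𝔬 𝔭 h33 hbHX1 hDv hDds hBi2 hc hκ hδJ hδ₃ hδ₃0 hδ₃J hBdX⟩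

end SmallGauge

end Literature.MathematicalPhysics.QuantumFieldTheory.Balaban1983to89.B9Thm33G0DirXHolderAtPins

end
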